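import Mathlib.RingTheory.Smooth.StandardSmoothOfFree
import Mathlib.RingTheory.Etale.Basic
import HarnessLib

/-!
# Étale algebras lift along nilpotent thickenings (SGA 1 I 8.1, 8.3 — affine form)

Topic `Literature/RingTheory/Etale`; theorems only. **Infinitesimal lifting of étale algebras**:
for a NILPOTENT ideal `N ⊆ R` and an étale `R ⧸ N`-algebra `B₀`, there is an étale `R`-algebra
`B` together with an `R`-algebra surjection `B → B₀` with kernel `N B`, i.e. `B ⧸ N B ≅ B₀`
(`exists_etale_of_etale_quotient`); if `B₀` is moreover finite (a «revêtement étale») then so is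
`B` (`exists_finite_etale_of_finite_etale_quotient`). This is the affine case of SGA 1 Exp. I
Prop. 8.1 / Thm. 8.3 («Le foncteur `X ↦ X₀ = X ×_S S₀` … est une équivalence de catégories» —
the existence half; the uniqueness half is I 5.5, in the tree
`AlgebraicGeometry/FundamentalGroup/EtaleExtensionOfLiftings`), alias the topological invariance
of the étale site (EGA IV 18.1.2) for affine nilpotent thickenings. It is the algebraic input of
the reduction «on peut supposer `X` réduit» in Riemann's existence theorem (SGA 1 XII 5.1, part 2
a)), attached to the named fact `FundamentalGroup.riemannExistence_finiteCovering`.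

## Proof

Not Grothendieck's (who lifts standard étale neighbourhoods, I 8.1, and glues them by I 5.5), but
a global one made possible by Mathlib: an étale algebra has a GLOBAL presentation as a standard
smooth algebra of relative dimension `0`, `B₀ ≅ (R⧸N)[Xᵢ]/(fⱼ)` with as many relations as
variables and invertible Jacobian (`Algebra.Etale.iff_isStandardSmoothOfRelativeDimension_zero`).
Lift the `fⱼ` coefficientwise to `f̃ⱼ ∈ R[Xᵢ]` and put `B = R[Xᵢ]/(f̃ⱼ)`; the natural surjection
`φ : B → B₀` has kernel `N B` (`MvPolynomial.ker_map`), a nil ideal, and maps the Jacobian of the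
lifted presentation to that of `B₀`, a unit; units lift along surjections with nil kernel
(`isUnit_of_map_of_ker_nil`), so the lifted presentation is submersive of relative dimension `0`
and `B` is étale. Finiteness: generators of `B₀` lift to `M ⊆ B` with `B = M + N B`, whence
`B = M + Nᵏ B = M` (`moduleFinite_of_surjective_of_ker_le_smul`, no a priori finiteness of `B`).

## References

* [SGA1] A. Grothendieck, M. Raynaud, *SGA 1* (LNM 224 / arXiv:math/0206203), Exp. I Prop. 8.1,
  Thm. 8.3 (pp. 13–15 of the original; p0016–p0017 of the materialised text), Thm. 5.5; Exp. XII
  Thm. 5.1 (proof, part 2 a)).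
* A. Grothendieck, *EGA* IV₄, Thm. 18.1.2 (invariance topologique du site étale).

#harness_tags algebraic_geometry.etale, ring_theory.deformation
-/

noncomputable section

open MvPolynomial

namespace Literature.RingTheory.Etale

universe u v

/-- A ring element whose image under a surjection with nil kernel is a unit is a unit. [folklore] -/
theorem isUnit_of_map_of_ker_nil {B C : Type*} [CommRing B] [CommRing C] (φ : B →+* C)
    (hφ : Function.Surjective φ) (hker : ∀ x ∈ RingHom.ker φ, IsNilpotent x) {b : B}
    (hb : IsUnit (φ b)) : IsUnit b := by
  obtain ⟨u, hu⟩ := hb.exists_right_inv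
  obtain ⟨c, rfl⟩ := hφ u
  have hn : IsNilpotent (b * c - 1) :=
    hker _ (by rw [RingHom.mem_ker, map_sub, map_mul, hu, map_one, sub_self])
  have h1 : IsUnit (b * c) := by
    have := hn.isUnit_add_one
    rwa [sub_add_cancel] at this
  exact isUnit_of_mul_isUnit_left h1

/-- **Finiteness lifts along nilpotent thickenings** (nilpotent Nakayama, no finiteness assumed on
`B`): if `φ : B → C` is an `R`-linear surjection onto a finite `R`-module whose kernel lies in
`N • B` for a NILPOTENT ideal `N`, then `B` is finite. [folklore] -/
theorem moduleFinite_of_surjective_of_ker_le_smul {R B C : Type*} [CommRing R] [AddCommGroup B]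
    [Module R B] [AddCommGroup C] [Module R C] (N : Ideal R) (hN : IsNilpotent N)
    (φ : B →ₗ[R] C) (hφ : Function.Surjective φ)
    (hker : LinearMap.ker φ ≤ N • (⊤ : Submodule R B)) [Module.Finite R C] : Module.Finite R B := by
  classical
  obtain ⟨s, hs⟩ := Module.Finite.fg_top (R := R) (M := C)
  -- lift the generators
  choose l hl using fun c : C ↦ hφ c
  let M : Submodule R B := Submodule.span R (Set.range fun c : s ↦ l c)
  have hM : ∀ b : B, b ∈ M ⊔ N • (⊤ : Submodule R B) := by
    intro b
    have hφb : φ b ∈ Submodule.span R (s : Set C) := by rw [hs]; trivial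
    -- write `φ b` as a combination of the generators and lift
    have : Submodule.span R (s : Set C) ≤ Submodule.map φ M := by
      rw [Submodule.span_le]
      intro c hc
      exact ⟨l c, Submodule.subset_span ⟨⟨c, hc⟩, rfl⟩, hl c⟩
    obtain ⟨m, hm, hmb⟩ := this hφb
    have hk : b - m ∈ LinearMap.ker φ := by rw [LinearMap.mem_ker, map_sub, hmb, sub_self]
    have := Submodule.add_mem_sup hm (hker hk)
    rwa [add_sub_cancel] at this
  -- iterate: `⊤ ≤ M ⊔ N ^ k • ⊤`
  have hiter : ∀ k : ℕ, (⊤ : Submodule R B) ≤ M ⊔ N ^ k • (⊤ : Submodule R B) := by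
    intro k
    induction k with
    | zero => simp
    | succ k ih =>
      intro b _
      have hb := ih (Submodule.mem_top : b ∈ ⊤)
      -- N^k • ⊤ ≤ N^k • (M ⊔ N • ⊤) ≤ M ⊔ N^(k+1) • ⊤
      have hstep : N ^ k • (⊤ : Submodule R B) ≤ M ⊔ N ^ (k + 1) • (⊤ : Submodule R B) := by
        calc N ^ k • (⊤ : Submodule R B) ≤ N ^ k • (M ⊔ N • (⊤ : Submodule R B)) :=
              Submodule.smul_mono le_rfl (fun b _ ↦ hM b)
          _ = N ^ k • M ⊔ N ^ (k + 1) • (⊤ : Submodule R B) := by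
              rw [Submodule.smul_sup, pow_succ, Submodule.mul_smul]
          _ ≤ M ⊔ N ^ (k + 1) • (⊤ : Submodule R B) :=
              sup_le_sup_right (Submodule.smul_le_right) _
      exact (sup_le le_sup_left hstep) hb
  obtain ⟨k, hk⟩ := hN
  have htop : (⊤ : Submodule R B) ≤ M := by
    have := hiter k
    rwa [hk, Ideal.zero_eq_bot, Submodule.bot_smul, sup_bot_eq] at this
  refine ⟨⟨s.image l, ?_⟩⟩
  rw [eq_top_iff]
  refine htop.trans (Submodule.span_le.mpr ?_)
  rintro _ ⟨c, rfl⟩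
  exact Submodule.subset_span (by simpa using ⟨c.1, c.2, rfl⟩)


/-- **Étale algebras lift along nilpotent thickenings** (SGA 1 I 8.1/8.3, affine form; EGA IV
18.1.2). Let `N ⊆ R` be a nilpotent ideal and `B₀` an ÉTALE `R ⧸ N`-algebra. Then there is an
étale `R`-algebra `B` with `B ⧸ N B ≅ B₀`: precisely an `R`-algebra surjection `φ : B → B₀` with
kernel `N B`. Proof: Mathlib's GLOBAL presentation of an étale algebra as a standard smooth
algebra of relative dimension `0` (`Algebra.Etale.iff_isStandardSmoothOfRelativeDimension_zero`:
`B₀ ≅ (R⧸N)[X₁…Xₙ]/(f₁…fₙ)` with invertible Jacobian) is lifted coefficientwise to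
`B = R[X₁…Xₙ]/(f̃₁…f̃ₙ)`; the Jacobian of the lift maps to that of `B₀` under `B → B₀`, whose kernel
`N B` is nil, so it is a unit and `B` is standard smooth of relative dimension `0`, i.e. étale.
(SGA 1 instead lifts standard étale pieces, I 8.1, and glues them by I 5.5.)
[cite: SGA1, Exp. I Prop. 8.1 and Thm. 8.3 (existence, affine case)] -/
theorem exists_etale_of_etale_quotient {R : Type u} [CommRing R] (N : Ideal R) (hN : IsNilpotent N)
    (B₀ : Type v) [CommRing B₀] [Algebra R B₀] [Algebra (R ⧸ N) B₀] [IsScalarTower R (R ⧸ N) B₀]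
    [Algebra.Etale (R ⧸ N) B₀] :
    ∃ (B : Type u) (_ : CommRing B) (_ : Algebra R B), Algebra.Etale R B ∧
      ∃ φ : B →ₐ[R] B₀, Function.Surjective φ ∧
        RingHom.ker φ.toRingHom = Ideal.map (algebraMap R B) N := by
  classical
  obtain ⟨ι, σ, _, _, P₀, hdim⟩ :=
    (Algebra.Etale.iff_isStandardSmoothOfRelativeDimension_zero.mp ‹Algebra.Etale (R ⧸ N) B₀›).out
  haveI := Fintype.ofFinite σ
  -- lift the relations of the presentation `P₀` of `B₀` to `R`
  have hmap : Function.Surjective (MvPolynomial.map (σ := ι) (Ideal.Quotient.mk N)) :=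
    map_surjective _ Ideal.Quotient.mk_surjective
  choose v hv using fun j : σ ↦ hmap (P₀.relation j)
  let I : Ideal (MvPolynomial ι R) := Ideal.span (Set.range v)
  let B : Type u := MvPolynomial ι R ⧸ I
  -- the `R`-algebra map `R[X] → B₀` through `(R ⧸ N)[X]`
  let ψ : MvPolynomial ι R →ₐ[R] B₀ := MvPolynomial.aeval P₀.val
  have hψ : ∀ p, ψ p = MvPolynomial.aeval P₀.val (MvPolynomial.map (Ideal.Quotient.mk N) p) := by
    intro p
    rw [← Ideal.Quotient.algebraMap_eq, MvPolynomial.aeval_map_algebraMap]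
  have hψv : ∀ j, ψ (v j) = 0 := fun j ↦ by
    rw [hψ, hv]
    exact P₀.aeval_val_relation j
  have hIψ : ∀ p ∈ I, ψ p = 0 := fun p hp ↦
    (Ideal.span_le (I := RingHom.ker ψ.toRingHom)).mpr (by rintro _ ⟨j, rfl⟩; exact hψv j) hp
  let φ : B →ₐ[R] B₀ := Ideal.Quotient.liftₐ I ψ hIψ
  have hφmk : ∀ p, φ (Ideal.Quotient.mk I p) = ψ p := fun p ↦ rfl
  -- `φ` is surjective
  have hφsurj : Function.Surjective φ := by
    intro b
    obtain ⟨p, hp⟩ := hmap (P₀.σ b)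
    refine ⟨Ideal.Quotient.mk I p, ?_⟩
    rw [hφmk, hψ, hp]
    exact P₀.aeval_val_σ b
  -- `ker φ = N B`
  have hrel : Set.range P₀.relation = MvPolynomial.map (Ideal.Quotient.mk N) '' Set.range v := by
    ext q
    constructor
    · rintro ⟨j, rfl⟩
      exact ⟨v j, ⟨j, rfl⟩, hv j⟩
    · rintro ⟨_, ⟨j, rfl⟩, rfl⟩
      exact ⟨j, (hv j).symm⟩
  have halgB : algebraMap R B = (Ideal.Quotient.mk I).comp MvPolynomial.C := rfl
  have hker : RingHom.ker φ.toRingHom = Ideal.map (algebraMap R B) N := by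
    apply le_antisymm
    · intro b hb
      obtain ⟨p, rfl⟩ := Ideal.Quotient.mk_surjective b
      replace hb : MvPolynomial.aeval P₀.val (MvPolynomial.map (Ideal.Quotient.mk N) p) = 0 := by
        rw [← hψ, ← hφmk]
        exact hb
      have h1 : MvPolynomial.map (Ideal.Quotient.mk N) p ∈
          I.map (MvPolynomial.map (Ideal.Quotient.mk N)) := by
        have : MvPolynomial.map (Ideal.Quotient.mk N) p ∈ P₀.ker := by
          rw [P₀.ker_eq_ker_aeval_val, RingHom.mem_ker]
          exact hb
        rwa [← P₀.span_range_relation_eq_ker, hrel, ← Ideal.map_span] at this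
      obtain ⟨q, hqI, hq⟩ := (Ideal.mem_map_iff_of_surjective _ hmap).mp h1
      have h2 : p - q ∈ Ideal.map MvPolynomial.C N := by
        have : p - q ∈ RingHom.ker (MvPolynomial.map (σ := ι) (Ideal.Quotient.mk N)) := by
          rw [RingHom.mem_ker, map_sub, hq, sub_self]
        rwa [MvPolynomial.ker_map, Ideal.mk_ker] at this
      have h3 : Ideal.Quotient.mk I p = Ideal.Quotient.mk I (p - q) := by
        rw [map_sub, Ideal.Quotient.eq_zero_iff_mem.mpr hqI, sub_zero]
      rw [h3, halgB, ← Ideal.map_map]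
      exact Ideal.mem_map_of_mem _ h2
    · rw [Ideal.map_le_iff_le_comap]
      intro n hn
      rw [Ideal.mem_comap, RingHom.mem_ker]
      change φ (algebraMap R B n) = 0
      rw [AlgHom.commutes, IsScalarTower.algebraMap_apply R (R ⧸ N) B₀,
        Ideal.Quotient.algebraMap_eq, Ideal.Quotient.eq_zero_iff_mem.mpr hn, map_zero]
  -- `ker φ` is nil
  have hkernil : ∀ x ∈ RingHom.ker φ.toRingHom, IsNilpotent x := by
    intro x hx
    rw [hker] at hx
    obtain ⟨k, hk⟩ := hN
    refine ⟨k, ?_⟩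
    have : x ^ k ∈ (Ideal.map (algebraMap R B) N) ^ k := Ideal.pow_mem_pow hx k
    rwa [← Ideal.map_pow, hk, Ideal.zero_eq_bot, Ideal.map_bot, Ideal.mem_bot] at this
  -- the lifted presentation of `B` and its Jacobian
  let Pn : Algebra.PreSubmersivePresentation R B ι σ :=
    Algebra.PreSubmersivePresentation.naive P₀.map P₀.map_inj
  have halg : ∀ p : MvPolynomial ι R, algebraMap Pn.Ring B p = Ideal.Quotient.mk I p := fun p ↦ rfl
  have hmat :
      (MvPolynomial.map (Ideal.Quotient.mk N)).mapMatrix Pn.jacobiMatrix = P₀.jacobiMatrix := by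
    ext i j
    rw [RingHom.mapMatrix_apply, Matrix.map_apply,
      Algebra.PreSubmersivePresentation.jacobiMatrix_naive,
      Algebra.PreSubmersivePresentation.jacobiMatrix_apply, ← MvPolynomial.pderiv_map, hv]
  have hjac : φ Pn.jacobian = P₀.jacobian := by
    rw [Pn.jacobian_eq_jacobiMatrix_det, P₀.jacobian_eq_jacobiMatrix_det, halg, hφmk, hψ,
      RingHom.map_det, hmat, P₀.algebraMap_apply]
  have hunit : IsUnit Pn.jacobian :=
    isUnit_of_map_of_ker_nil φ.toRingHom hφsurj hkernil (by
      change IsUnit (φ Pn.jacobian)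
      rw [hjac]
      exact P₀.jacobian_isUnit)
  let Ps : Algebra.SubmersivePresentation R B ι σ := ⟨Pn, hunit⟩
  haveI : Algebra.IsStandardSmoothOfRelativeDimension 0 R B :=
    Ps.isStandardSmoothOfRelativeDimension hdim
  exact ⟨B, inferInstance, inferInstance, inferInstance, φ, hφsurj, hker⟩

/-- **Finite étale algebras lift along nilpotent thickenings** (SGA 1 I 8.3 for «revêtements
étales», affine base): with `N` nilpotent and `B₀` FINITE étale over `R ⧸ N`, the lift `B` of
`exists_etale_of_etale_quotient` is finite étale over `R` (nilpotent Nakayama,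
`moduleFinite_of_surjective_of_ker_le_smul`).
[cite: SGA1, Exp. I Thm. 8.3 and Prop. 8.1 («énoncé analogue pour des revêtements étales»)] -/
theorem exists_finite_etale_of_finite_etale_quotient {R : Type u} [CommRing R] (N : Ideal R)
    (hN : IsNilpotent N) (B₀ : Type v) [CommRing B₀] [Algebra R B₀] [Algebra (R ⧸ N) B₀]
    [IsScalarTower R (R ⧸ N) B₀] [Algebra.Etale (R ⧸ N) B₀] [Module.Finite (R ⧸ N) B₀] :
    ∃ (B : Type u) (_ : CommRing B) (_ : Algebra R B), Algebra.Etale R B ∧ Module.Finite R B ∧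
      ∃ φ : B →ₐ[R] B₀, Function.Surjective φ ∧
        RingHom.ker φ.toRingHom = Ideal.map (algebraMap R B) N := by
  obtain ⟨B, _, _, hB, φ, hφ, hker⟩ := exists_etale_of_etale_quotient N hN B₀
  haveI : Module.Finite R B₀ := by
    haveI : Module.Finite R (R ⧸ N) :=
      Module.Finite.of_surjective (Ideal.Quotient.mkₐ R N).toLinearMap Ideal.Quotient.mk_surjective
    exact Module.Finite.trans (R ⧸ N) B₀
  refine ⟨B, inferInstance, inferInstance, hB, ?_, φ, hφ, hker⟩
  refine moduleFinite_of_surjective_of_ker_le_smul N hN φ.toLinearMap hφ fun b hb ↦ ?_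
  have hb' : b ∈ Ideal.map (algebraMap R B) N := by rw [← hker]; exact hb
  rw [Ideal.smul_top_eq_map]
  exact hb'

end Literature.RingTheory.Etale

end
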